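import Summits.BirchSwinnertonDyer.BirchSwinnertonDyer.Theorems.SylvesterTwoHeegnerIndexShaDescentOrderForm
import HarnessLib

/-!
# LEMMA K0 / LEMMA D on the tree's `Ш`: the PACKAGED descent datum `(φ, r, w, s)` with ONE `w` —
# so that (WRAP-CT)'s `𝒪`-balanced Cassels–Tate pairing and the descent bijection speak of the same
# operator (input of the TAIL's (T-L4) assembly, crux `UpperOffV0HSYPlus`, stmt-BirchSwinnertonDyer-19804)

`SylvesterTwoShaDescentOrderForm.exists_descent_bijective` (k7t-c2 g19, k-ty1 hand-over v4) exports
`r : Ш(E/ℚ)[2^∞] → Ш(E_K/K)[2^∞]` (under `shaRestriction`) and `w` with `w² + w + 1 = 0` and the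
bijection `(c, d) ↦ r c + w (r d)`, but DISCARDS the endo-isogeny `φ` of
`SylvesterTwoShaConjugation.exists_lemmaD_data` under which `w` lies (its `-` pattern) and the
conjugation operator `s`.  The coupled telescope's census theorems
(`…CoupledTelescopeTailFour/Seven`, leaf (T-L4)) need, on the SAME `w`: (i) k-ty1's (WRAP-CT)
`exists_casselsTate_twoPrimary_omegaBalanced_of_galH1` (p693884), whose binder is the `H¹`-level
compatibility `↑(w x) = galH1Map φ … ↑x`; (ii) the descent bijection / `r(Ш(E/ℚ)) = ` the
`s`-invariants (`…CoupledTelescopeLagrangian.coisotropic_closure_descent`'s `hsurj`); (iii) `s` itself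
(the (CT-3′) consequence `B_K (r a) (w (r b)) = −B_ℚ a b` is stated through `res ∘ cor = 1 + s`).  Two
separate `∃`-statements cannot be glued, so this file re-runs g19's proof KEEPING every component:

* `exists_descent_package` — for `E = W/ℚ` a `j = 0` short model (`a₁ = ⋯ = a₄ = 0`), `K` totally
  complex quadratic with `ζ`, `σ ζ = ζ²`, `σ² = 1`: `∃ φ r w s` with `↑(r c) = shaRestriction W K c`,
  `↑(w x) = galH1Map φ ↑x` (H¹-level), `↑(s x) = conjH1Points ↑x`, `w² + w + 1 = 0`, `s² = 1`,
  `s (w x) = −s x − w (s x)`, `3` bijective on `Ш(E_K)[2^∞]`, `s (r c) = r c`,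
  `s y = y → ∃ c, r c = y`, `r` injective, and `(c, d) ↦ r c + w (r d)` bijective;
* `exists_descent_package_of_omega` — binder form (`ω² + ω + 1 = 0`, `finrank ℚ K = 2`) on
  `⟨0, 0, 0, 0, b⟩`, the currency of `HuShuYin2019.cubeSumCurve` and of the census theorems' hT.

Theorem-only (no definition, no named fact); nothing asserted on 19804; BSD not claimed for any curve.
Sources: MEMO-bsd-cm-two §57.1 (Lemma K0), §59.1 (iii); Gross 1991 §5 (5.1); Milne ADT I §6.
-/

-- every Summits module is named `Summit.<Summit>.<Problem>…`: the duplicated component is by design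
set_option linter.dupNamespace false
set_option autoImplicit false

noncomputable section

open scoped Classical

open WeierstrassCurve Literature.NumberTheory.EllipticCurves
  Literature.NumberTheory.GaloisRepresentations NumberField

namespace Summit.BirchSwinnertonDyer.BirchSwinnertonDyer.Theorems.SylvesterTwoShaDescentOrderForm

variable (W : WeierstrassCurve ℚ) [W.IsElliptic] (K : Type) [Field K] [NumberField K]
variable {σ : K ≃ₐ[ℚ] K}

/-- **The packaged descent datum `(φ, r, w, s)` on `Ш(E_K/K)[2^∞]` with ONE `w`** (LEMMA K0 /
LEMMA D on the tree's genuine `Ш`; memo two §57.1): see the module docstring.  Proof = g19's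
`exists_descent_bijective` with the isogeny `φ`, the `H¹`-compatibility of `w` and the conjugation
operator `s` of `SylvesterTwoShaConjugation.exists_lemmaD_data` RETAINED.
[cite: GrossLMS1991, §5 (5.1)] [cite: MilneADT2006, Ch. I §6 p. 75] -/
theorem exists_descent_package (hK : ∀ v : InfinitePlace K, v.IsComplex) (hσ2 : σ * σ = 1)
    (ha₁ : W.a₁ = 0) (ha₂ : W.a₂ = 0) (ha₃ : W.a₃ = 0) (ha₄ : W.a₄ = 0)
    (h2 : Module.finrank ℚ K = 2) {ζ : K} (hζ : IsPrimitiveRoot ζ 3) (hσζ : σ ζ = ζ ^ 2) :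
    ∃ (φ : Isogeny (W.baseChange K) (W.baseChange K))
      (r : AddCommGroup.primaryComponent W.sha 2 →+
        AddCommGroup.primaryComponent (W.baseChange K).sha 2)
      (w s : AddCommGroup.primaryComponent (W.baseChange K).sha 2 →+
        AddCommGroup.primaryComponent (W.baseChange K).sha 2),
      (∀ c, ((r c : AddCommGroup.primaryComponent (W.baseChange K).sha 2) :
        (W.baseChange K).sha) = shaRestriction W K c) ∧
      (∀ x, (((w x : AddCommGroup.primaryComponent (W.baseChange K).sha 2) :
          (W.baseChange K).sha) : (W.baseChange K).galH1) =
        galH1Map φ.toAddMonoidHom φ.equivariant ((x : (W.baseChange K).sha) : (W.baseChange K).galH1)) ∧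
      (∀ x, (((s x : AddCommGroup.primaryComponent (W.baseChange K).sha 2) :
          (W.baseChange K).sha) : (W.baseChange K).galH1) =
        (isLiftOfAut_liftAut σ).conjH1Points W ((x : (W.baseChange K).sha) : (W.baseChange K).galH1)) ∧
      (∀ x, w (w x) + w x + x = 0) ∧ (∀ x, s (s x) = x) ∧ (∀ x, s (w x) = -(s x) - w (s x)) ∧
      (Function.Bijective fun x : AddCommGroup.primaryComponent (W.baseChange K).sha 2 =>
        (3 : ℤ) • x) ∧
      (∀ c, s (r c) = r c) ∧ (∀ y, s y = y → ∃ c, r c = y) ∧ Function.Injective r ∧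
      Function.Bijective fun cd : AddCommGroup.primaryComponent W.sha 2 ×
          AddCommGroup.primaryComponent W.sha 2 ↦ r cd.1 + w (r cd.2) := by
  obtain ⟨φ, w, s, hwφ, hs, hw, hss, hsw, h3⟩ := SylvesterTwoShaConjugation.exists_lemmaD_data W hK
    (isLiftOfAut_liftAut σ) hσ2 (baseChange_eq_of_a_eq_zero W K ha₁ ha₂ ha₃ ha₄) hζ hσζ
  have hdesc := SylvesterTwoUnramifiedDescent.descent_bijective w s hw hss hsw h3
  have hinj := JZero.shaRestriction_injective_of_isPrimitiveRoot W K ha₁ ha₂ ha₃ ha₄ h2 hζ hσζ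
  let r : AddCommGroup.primaryComponent W.sha 2 →+
      AddCommGroup.primaryComponent (W.baseChange K).sha 2 :=
    ((shaRestriction W K).comp (AddCommGroup.primaryComponent W.sha 2).subtype).codRestrict _
      fun c ↦ map_mem_primaryComponent (shaRestriction W K) c.2
  have hr : ∀ c, ((r c : AddCommGroup.primaryComponent (W.baseChange K).sha 2) :
      (W.baseChange K).sha) = shaRestriction W K c := fun _ ↦ rfl
  -- `r` lands in the `s`-invariants
  have hsr : ∀ c, s (r c) = r c := by
    intro c
    apply Subtype.ext
    apply Subtype.ext
    rw [hs, hr, conjH1Points_shaRestriction]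
  -- `r` is injective
  have hrinj : Function.Injective r := by
    intro c c' h
    have h' : shaRestriction W K c = shaRestriction W K c' := by
      rw [← hr, ← hr, show r c = r c' from h]
    exact Subtype.ext (hinj h')
  -- `r` is onto the `s`-invariants
  have hronto : ∀ y, s y = y → ∃ c, r c = y := by
    intro y hy
    have hinv : (isLiftOfAut_liftAut σ).conjH1Points W
        (((y : AddCommGroup.primaryComponent (W.baseChange K).sha 2) : (W.baseChange K).sha) :
          (W.baseChange K).galH1) = (y : (W.baseChange K).sha) := by
      rw [← hs, hy]
    obtain ⟨s₀, hs₀⟩ :=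
      JZero.exists_shaRestriction_eq_of_conjH1Points_eq K W ha₁ ha₂ ha₃ ha₄ h2 hζ hσζ hinv
    have hs₀mem : s₀ ∈ AddCommGroup.primaryComponent W.sha 2 := by
      obtain ⟨k, hk⟩ := AddCommGroup.mem_primaryComponent.mp y.2
      refine AddCommGroup.mem_primaryComponent.mpr ⟨k, hinj ?_⟩
      rw [map_nsmul, hs₀, map_zero]
      exact hk
    exact ⟨⟨s₀, hs₀mem⟩, Subtype.ext hs₀⟩
  -- the codomain restriction of `r` to the `s`-invariants is a bijection
  have hker : ∀ c, r c ∈ (s - AddMonoidHom.id _).ker := by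
    intro c
    rw [AddMonoidHom.mem_ker, AddMonoidHom.sub_apply, AddMonoidHom.id_apply, sub_eq_zero]
    exact hsr c
  let r' : AddCommGroup.primaryComponent W.sha 2 →+ (s - AddMonoidHom.id _).ker :=
    r.codRestrict _ hker
  have hbij' : Function.Bijective r' := by
    refine ⟨fun c c' h ↦ hrinj (congrArg Subtype.val h), ?_⟩
    rintro ⟨y, hy⟩
    have hy' : s y = y := by
      rw [AddMonoidHom.mem_ker, AddMonoidHom.sub_apply, AddMonoidHom.id_apply, sub_eq_zero] at hy
      exact hy
    obtain ⟨c, hc⟩ := hronto y hy'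
    exact ⟨c, Subtype.ext hc⟩
  refine ⟨φ, r, w, s, hr, hwφ, hs, hw, hss, hsw, h3, hsr, hronto, hrinj, ?_⟩
  -- `(c, d) ↦ r c + w (r d)` is `descent ∘ (r' × r')`
  have hcomp : (fun cd : AddCommGroup.primaryComponent W.sha 2 ×
      AddCommGroup.primaryComponent W.sha 2 ↦ r cd.1 + w (r cd.2)) =
      (fun st : (s - AddMonoidHom.id _).ker × (s - AddMonoidHom.id _).ker ↦
        (st.1 : AddCommGroup.primaryComponent (W.baseChange K).sha 2) + w st.2) ∘
      (fun cd ↦ (r' cd.1, r' cd.2)) := rfl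
  rw [hcomp]
  exact hdesc.comp ⟨fun a b h ↦ Prod.ext (hbij'.1 (Prod.mk.inj h).1) (hbij'.1 (Prod.mk.inj h).2),
    fun st ↦ ⟨((hbij'.2 st.1).choose, (hbij'.2 st.2).choose),
      Prod.ext (hbij'.2 st.1).choose_spec (hbij'.2 st.2).choose_spec⟩⟩

/-- **Packaged descent datum, binder form** (the convention `(K : Type) (ω : K), ω² + ω + 1 = 0 →
finrank ℚ K = 2` of `HuShuYin2019.shaAnPair_mul_height_eq_two_zpow_mul_height` / the census theorems'
hT) on a `j = 0` short model `⟨0, 0, 0, 0, b⟩` (`= cubeSumCurve n` by `rfl`): the involution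
`σ ∈ Aut(K/ℚ)` with `σ ω = ω²`, total complexity and `ζ := ω` are supplied by
`JZero.exists_aut_apply_eq_sq`. [cite: GrossLMS1991, §5 (5.1)] [cite: MilneADT2006, Ch. I §6 p. 75] -/
theorem exists_descent_package_of_omega {b : ℚ} [(⟨0, 0, 0, 0, b⟩ : WeierstrassCurve ℚ).IsElliptic]
    {ω : K} (hω : ω ^ 2 + ω + 1 = 0) (h2 : Module.finrank ℚ K = 2) :
    ∃ (σ : K ≃ₐ[ℚ] K) (_ : σ ω = ω ^ 2) (_ : σ * σ = 1)
      (φ : Isogeny ((⟨0, 0, 0, 0, b⟩ : WeierstrassCurve ℚ).baseChange K)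
        ((⟨0, 0, 0, 0, b⟩ : WeierstrassCurve ℚ).baseChange K))
      (r : AddCommGroup.primaryComponent (⟨0, 0, 0, 0, b⟩ : WeierstrassCurve ℚ).sha 2 →+
        AddCommGroup.primaryComponent ((⟨0, 0, 0, 0, b⟩ : WeierstrassCurve ℚ).baseChange K).sha 2)
      (w s : AddCommGroup.primaryComponent ((⟨0, 0, 0, 0, b⟩ : WeierstrassCurve ℚ).baseChange K).sha 2
        →+ AddCommGroup.primaryComponent ((⟨0, 0, 0, 0, b⟩ : WeierstrassCurve ℚ).baseChange K).sha 2),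
      (∀ c, ((r c : AddCommGroup.primaryComponent
          ((⟨0, 0, 0, 0, b⟩ : WeierstrassCurve ℚ).baseChange K).sha 2) :
        ((⟨0, 0, 0, 0, b⟩ : WeierstrassCurve ℚ).baseChange K).sha) =
          shaRestriction (⟨0, 0, 0, 0, b⟩ : WeierstrassCurve ℚ) K c) ∧
      (∀ x, (((w x : AddCommGroup.primaryComponent
          ((⟨0, 0, 0, 0, b⟩ : WeierstrassCurve ℚ).baseChange K).sha 2) :
          ((⟨0, 0, 0, 0, b⟩ : WeierstrassCurve ℚ).baseChange K).sha) :
            ((⟨0, 0, 0, 0, b⟩ : WeierstrassCurve ℚ).baseChange K).galH1) =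
        galH1Map φ.toAddMonoidHom φ.equivariant
          ((x : ((⟨0, 0, 0, 0, b⟩ : WeierstrassCurve ℚ).baseChange K).sha) :
            ((⟨0, 0, 0, 0, b⟩ : WeierstrassCurve ℚ).baseChange K).galH1)) ∧
      (∀ x, (((s x : AddCommGroup.primaryComponent
          ((⟨0, 0, 0, 0, b⟩ : WeierstrassCurve ℚ).baseChange K).sha 2) :
          ((⟨0, 0, 0, 0, b⟩ : WeierstrassCurve ℚ).baseChange K).sha) :
            ((⟨0, 0, 0, 0, b⟩ : WeierstrassCurve ℚ).baseChange K).galH1) =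
        (isLiftOfAut_liftAut σ).conjH1Points (⟨0, 0, 0, 0, b⟩ : WeierstrassCurve ℚ)
          ((x : ((⟨0, 0, 0, 0, b⟩ : WeierstrassCurve ℚ).baseChange K).sha) :
            ((⟨0, 0, 0, 0, b⟩ : WeierstrassCurve ℚ).baseChange K).galH1)) ∧
      (∀ x, w (w x) + w x + x = 0) ∧ (∀ x, s (s x) = x) ∧ (∀ x, s (w x) = -(s x) - w (s x)) ∧
      (Function.Bijective fun x : AddCommGroup.primaryComponent
        ((⟨0, 0, 0, 0, b⟩ : WeierstrassCurve ℚ).baseChange K).sha 2 => (3 : ℤ) • x) ∧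
      (∀ c, s (r c) = r c) ∧ (∀ y, s y = y → ∃ c, r c = y) ∧ Function.Injective r ∧
      Function.Bijective fun cd : AddCommGroup.primaryComponent
          (⟨0, 0, 0, 0, b⟩ : WeierstrassCurve ℚ).sha 2 ×
        AddCommGroup.primaryComponent (⟨0, 0, 0, 0, b⟩ : WeierstrassCurve ℚ).sha 2 ↦
          r cd.1 + w (r cd.2) := by
  obtain ⟨hζ, hK, σ, hσζ, hσ2⟩ := JZero.exists_aut_apply_eq_sq K hω h2
  obtain ⟨φ, r, w, s, h⟩ :=
    exists_descent_package ⟨0, 0, 0, 0, b⟩ K hK hσ2 rfl rfl rfl rfl h2 hζ hσζ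
  exact ⟨σ, hσζ, hσ2, φ, r, w, s, h⟩

end Summit.BirchSwinnertonDyer.BirchSwinnertonDyer.Theorems.SylvesterTwoShaDescentOrderForm

end
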